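/-
Copyright (c) 2026 the pub-hodgecm-mathlib formalisation cell (harness21).  Prover seat hodgecm-mathlib-LH4-p08 (g8), req620 Track A «(D-RAM) FOUR-FRAME» squad, helper lane
on h413 = stmt-HodgeConjecture-24833 (count-neutral).  STAGE-1b, row (2) cone road: (D3♯)-Unr «THE TOP ROW OF THE SCALED MULTIPLIER, TYPE U — ALIVE UP TO THE UNSCALED
CONDUCTOR» (the type-U twin of LH4-p07 (g9)'s `…RamKTopValueScaled`; T5a lineage LH4-p08 (g4–g5)).  2026-09-04.
-/
import Summits.HodgeConjecture.HodgeConjecture.Theorems.F0P3cDyRamToricLevelCensusUnrTopSide    -- ★ p857722 (this lineage, g5): `token_kappa`, `min_le_of_thetaFixed_near`, `topBit_hyper_iff`; brings ★ TopSidePrep (EXISTENCE ∕ coset reps)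
import Summits.HodgeConjecture.HodgeConjecture.Theorems.F0P3cDyRamToricLevelCensusUnrTop        -- ★ p857538 (this lineage, g5): `ncard_levelSetDep_top_hyper` (any multiplier)
import Summits.HodgeConjecture.HodgeConjecture.Theorems.F0P3cDyRamToricLevelCensusUnrTopAniso   -- ★ p857647 (this lineage, g5): `ncard_levelSetDep_top_aniso` (any multiplier)
import HarnessLib

/-!
# T5a (type U), (D3♯): THE TOP ROW OF A SCALED MULTIPLIER `μ₁ = t⁻¹(λ − u)` — the (R1-TOP-SIDE) bit at a FREE threshold, and the sheet-v5 `hvTop` sentences of `μ₁` with the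
# alive conjunct `2j + d ≤ 2jλ₁ + 1 + e`, `e = v(t)`

Cell `hodgecm-mathlib` (D-0151), FLOOR 0, crux item H413 = `stmt-HodgeConjecture-24833`, route of record `HCCMUnconditional`; squad F0∕P3c∕LH4 (req618∕req620); helper lane
`--supports stmt-HodgeConjecture-24833 --as helper` (count-neutral).  THEOREMS ONLY (no `def`, no instance, no notation, no `sorry`; default heartbeats).

WHY (LH4-p07 (g9) ★ p859713 ∕ ★ p859832; this seat's ★ p859859 ∕ p859898 offset twins).  The cone cells of a level template piece `lev_{a′,b′}` are the cells of the SCALED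
multiplier `μ₁ = (jE c)⁻¹(λ − u)` with `|jE c| = exp(−a′)`, `jE c` `ρ`-fixed.  Its off-diagonal ∕ low tables are the unit's at `μ₁`'s tokens `(m₁, jλ₁) = (m − a′, jλ − a′)`
(★ T5a (R1) lemmas take any multiplier), and so is the INDEX form of its top cells (★ `ncard_levelSetDep_top_hyper` ∕ `_top_aniso`, any multiplier) — but the top cells' BIT
`[∃ Θ-fixed unit N : |(ρh∕h)(ρN∕N) + ρμ₁∕μ₁| ≤ exp(−(j + a − m₁))]` is a statement about the twist `κ = ρμ₁∕μ₁ = ρμ∕μ` of the UNSCALED `μ = λ − u`, whose two depths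
`|κ − 1| = exp(−(jλ − m))` and `|κ − Θκ| = exp(−jλ)` (★ `token_kappa`) live in the unit's tokens; at `μ₁`'s cell `(j, a)` the threshold is `s = j + a − m₁ = 2j − jλ₁`, which for
odd `a′` is NOT a threshold of any unit cell.  So:
* §1 `topBit_hyper_iff_threshold` ∕ `topBit_aniso_iff_threshold` — ★ `topBit_hyper_iff` ∕ ★ `topBit_aniso_iff` with the cell threshold replaced by a FREE `s` past the twist's
  depth (`jl < s + m`): bit ⟺ `(∃ k, d + m + 2k = jλ) ∧ s + d ≤ jλ + 1` (hyperbolic) ∕ `jλ + 1 = d + m ∧ s + d ≤ jλ + 1` (anisotropic) — the ★ proofs verbatim with `s` for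
  `j + a − m` (★ `min_le_of_thetaFixed_near`, ★ `exists_thetaFixed_normOne_near`);
* §2 **`ncard_levelSetDep_top_hyper_inv_mul`** ∕ **`ncard_levelSetDep_top_aniso_inv_mul`** — for `μ₁ = t⁻¹(λ − u)` (`ρ t = t`, `|t| = exp(−e)`, tokens `m₁ + e = m`,
  `jλ₁ + e = jλ`) on a top cell of `μ₁` (`j ≤ jλ₁`, `1 ≤ a`, `j + m₁ = jλ₁ + a`, `m₁ + 1 ≤ 2a`):
  `(q−1)q^{⌈(2a−m₁)∕2⌉−1}·#levelSetDep_h(j,a;μ₁) = [(d + m₁ ≤ jλ₁ ∧ jλ₁ − d − m₁ even) ∧ 2j + d ≤ 2jλ₁ + 1 + e]·#levelSet_h(j,a)` (hyperbolic `h`) and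
  `q^{⌊(2a−m₁)∕2⌋}·#levelSetDep_{h′}(j,a;μ₁) = [jλ₁ + 1 = d + m₁ ∧ 2j + d ≤ 2jλ₁ + 1 + e]·#levelSet_{h′}(j,a)` (anisotropic `h′`) — i.e. the sheet-v5 `hvTopP ∕ hvTopM`
  sentences of ★ `toricCensusSum_unr_v5` at `μ₁`'s tokens with the alive conjunct SHIFTED by **`e = v(t)`** — exactly the `hvTopPE ∕ hvTopME` letters of ★ p859898 §2
  `toricCensusSum_unr_v5_flip_cutoff_offset` and of `toricCensusSum_unr_v5_cutoff_offset`, with the offset PROVED (`e = a′` for `t = jE ϖ^{a′}`).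
HONEST LABEL.  Count-neutral (`--supports`): local DVR algebra on abstract letters; no census LAW is stated; pays no registered stub and touches no `Lines/` module; the seven
tier-0 ED. 5 sorries stay OPEN; `HC_CM` is proved only modulo the 7 printed citations (2 remaining named inputs: hLiu418 = `stmt-HodgeConjecture-24832`, h413 =
`stmt-HodgeConjecture-24833`) until rung 0 closes.

## References
* [Serre1979] J.-P. Serre, *Local Fields*, GTM 67 (1979): Ch. V §3 Prop. 5, Cor. 3 (unit filtration and norms in a ramified quadratic extension).
* [Jacobowitz1962] R. Jacobowitz, *Hermitian forms over local fields*, Amer. J. Math. 84 (1962): §4.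
* [Flicker1998UnitaryFL] Y. Z. Flicker, *Elementary proof of the fundamental lemma for a unitary group*, Canad. J. Math. 50 (1998): Prop. 7 p. 84 (the level tables).
* [Kottwitz1986BaseChangeUnits] R. E. Kottwitz, *Base change for unit elements of Hecke algebras*, Compositio Math. 60 (1986): §1 pp. 240–241.
-/

set_option autoImplicit false

open WithZero IsLocalRing
open scoped Valued

namespace Summit.HodgeConjecture.HodgeConjecture.Cruxes.H413.F0P3cDyRamToricLevelCensusUnrTopScaled

open Summit.HodgeConjecture.HodgeConjecture.Cruxes.H413.F0P3cDyRamToricCensusDefs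
open Summit.HodgeConjecture.HodgeConjecture.Cruxes.H413.F0P3cDyRamToricLevelCensusUnr
open Literature.NumberTheory.LocalFields.QuadraticOrder Literature.NumberTheory.LocalFields.WildQuadraticDatum

variable {K : Type*} [Field K] [Valued K ℤᵐ⁰] {ρ Θ : K →+* K} {α ϖE h : K} {d t q : ℕ}
variable {K' : Type*} [Field K'] [Valued K' ℤᵐ⁰] {σ' : K' →+* K'} {π' : K'}

/-! ## §1 The (R1-TOP-SIDE) bit laws at a free threshold -/

/-- **(R1-TOP-SIDE, HYPERBOLIC) AT A FREE THRESHOLD.**  ★ `topBit_hyper_iff` with the cell threshold `j + a − m` replaced by any `s` past the twist's own depth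
(`jλ − m < s`, i.e. `jl < s + m`): `[∃ Θ-fixed unit N : |(ρh∕h)(ρN∕N) + ρμ∕μ| ≤ exp(−s)] ⟺ (∃ k, d + m + 2k = jλ) ∧ s + d ≤ jλ + 1` — the same proof (★
`min_le_of_thetaFixed_near` ∕ ★ `exists_thetaFixed_normOne_near`): `κ = ρμ∕μ` is within `exp(−s)` of the unit coset of `T♮` iff `s ≤ jλ − d + 1`.  Needed because a
SCALED multiplier `t⁻¹μ` has the same `κ` but cells at thresholds `2j − jλ + e`, off the unit's diagonal lattice when `e` is odd.
[cite: Serre1979, Ch. V §3 Prop. 5, Cor. 3] [cite: Jacobowitz1962, §4] [cite: Flicker1998UnitaryFL, p. 84] -/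
theorem topBit_hyper_iff_threshold [IsAdicComplete 𝓂[K'] 𝒪[K']]
    (hρρ : ∀ x, ρ (ρ x) = x) (hvρ : ∀ x, Valued.v (ρ x) = Valued.v x) (hΘΘ : ∀ x, Θ (Θ x) = x) (hΘρ : ∀ x, Θ (ρ x) = ρ (Θ x))
    (hvΘ : ∀ x, Valued.v (Θ x) = Valued.v x) (hα1 : Valued.v α ≤ 1) (hα : Valued.v (α - ρ α) = 1)
    (hρϖE : ρ ϖE = ϖE) (hϖE : Valued.v ϖE = exp (-1 : ℤ)) (h2 : Valued.v (2 : K) = Valued.v ϖE ^ t) (_hΘh : Θ h = h) (hh : h ≠ 0)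
    (hσ' : ∀ x, σ' (σ' x) = x) (hvσ' : ∀ x, Valued.v (σ' x) = Valued.v x) (hfix' : ∀ x : K', σ' x = x → x ≠ 0 → ∃ n : ℤ, Valued.v x = exp (2 * n))
    (hπ' : Valued.v π' = exp (-1 : ℤ)) (hdd' : Valued.v (π' - σ' π') = Valued.v π' ^ d) (hd : 1 ≤ d)
    (jK : K' →+* K) (hjv : ∀ x, Valued.v (jK x) = Valued.v x) (hjΘ : ∀ x, Θ (jK x) = jK x)
    (hjfix : ∀ z : K, Θ z = z → ∃ x, jK x = z) (hjσ : ∀ x, jK (σ' x) = ρ (jK x))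
    (hnorm : ∀ z : Kˣ, Θ (z : K) = z → Valued.v (z : K) = 1 → ∃ ω : Kˣ, Valued.v (ω : K) = 1 ∧ (ω : K) * Θ ω = z)
    (hhyper : ∃ x : K, x ≠ 0 ∧ h * Θ x * x + ρ (h * Θ x * x) = 0)
    {lam u : K} (hlam : lam * Θ lam = 1) (hu : ρ u = u) (hu1 : u * Θ u = 1)
    {m jl : ℕ} (hm : Valued.v (lam - u) = exp (-(m : ℤ))) (hjl : Valued.v ((lam - u) - ρ (lam - u)) = exp (-(jl : ℤ)))
    (s : ℕ) (hs : jl < s + m) :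
    (∃ N : K, Θ N = N ∧ Valued.v N = 1 ∧ Valued.v (ρ h / h * (ρ N / N) + ρ (lam - u) / (lam - u)) ≤ exp (-(s : ℤ))) ↔
      ((∃ k : ℕ, d + m + 2 * k = jl) ∧ s + d ≤ jl + 1) := by
  obtain ⟨hκ1, hκ, hκm, hκΘ, hmjl⟩ := token_kappa hρρ hvρ hΘρ hvΘ hlam hu hu1 hm hjl
  set κ : K := ρ (lam - u) / (lam - u) with hκdef
  have hρh0 : ρ h ≠ 0 := (map_ne_zero ρ).2 hh
  -- the unit translator of the hyperbolic side: `η·t(ω₀) = −1`, `N₀ = ω₀Θω₀`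
  obtain ⟨ω₀, hω₀, hη⟩ := exists_unit_twist_eq_of_isotropic hΘρ hϖE hρϖE hh hhyper
  have hN00 : (ω₀ : K) * Θ ω₀ ≠ 0 := mul_ne_zero ω₀.ne_zero ((map_ne_zero Θ).2 ω₀.ne_zero)
  have hN0Θ : Θ ((ω₀ : K) * Θ ω₀) = (ω₀ : K) * Θ ω₀ := by rw [map_mul, hΘΘ, mul_comm]
  have hvN0 : Valued.v ((ω₀ : K) * Θ ω₀) = 1 := by rw [map_mul, hvΘ, hω₀, mul_one]
  constructor
  · rintro ⟨N, hΘN, hN1, hbit⟩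
    have hN0 : N ≠ 0 := fun h0 => by rw [h0, map_zero] at hN1; exact zero_ne_one hN1
    -- `x := −η·ρN∕N = ρN₂∕N₂` with `N₂ = N ∕ N₀`
    obtain ⟨n₂, hn₂⟩ := hjfix (N / ((ω₀ : K) * Θ ω₀)) (by rw [map_div₀, hΘN, hN0Θ])
    have hvn₂ : Valued.v n₂ = 1 := by rw [← hjv, hn₂, map_div₀, hN1, hvN0, div_one]
    have hn₂0 : n₂ ≠ 0 := fun h0 => by rw [h0, map_zero] at hvn₂; exact zero_ne_one hvn₂
    have hxeq : -(ρ h / h * (ρ N / N)) = jK (σ' n₂) / jK n₂ := by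
      rw [hjσ, hn₂, map_div₀]
      have hη' : ρ h / h = -(((ω₀ : K) * Θ ω₀) / ρ ((ω₀ : K) * Θ ω₀)) := by
        have hρN00 : ρ ((ω₀ : K) * Θ ω₀) ≠ 0 := (map_ne_zero ρ).2 hN00
        calc ρ h / h = ρ h / h * (ρ ((ω₀ : K) * Θ ω₀) / ((ω₀ : K) * Θ ω₀)) * (((ω₀ : K) * Θ ω₀) / ρ ((ω₀ : K) * Θ ω₀)) := by
              rw [mul_assoc, div_mul_div_comm, mul_comm (ρ ((ω₀ : K) * Θ ω₀)) ((ω₀ : K) * Θ ω₀), div_self (mul_ne_zero hN00 hρN00), mul_one]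
          _ = -(((ω₀ : K) * Θ ω₀) / ρ ((ω₀ : K) * Θ ω₀)) := by rw [hη, neg_one_mul]
      rw [hη']
      field_simp
    set x : K := jK (σ' n₂) / jK n₂ with hxdef
    have hΘx : Θ x = x := by rw [hxdef, map_div₀, hjΘ, hjΘ]
    have hx : x * ρ x = 1 := by
      rw [hxdef, map_div₀, ← hjσ, ← hjσ, hσ', div_mul_div_comm, mul_comm (jK (σ' n₂)) (jK n₂), div_self]
      exact mul_ne_zero ((map_ne_zero jK).2 hn₂0) ((map_ne_zero jK).2 ((map_ne_zero σ').2 hn₂0))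
    have hκx : Valued.v (κ - x) ≤ exp (-(s : ℤ)) := by
      rw [← hxeq, sub_neg_eq_add, add_comm]; exact hbit
    -- the depth of `x` is `ℓ = jλ − m`, and lies in `d + 2ℕ`
    have hs0 : jl - m < s := by omega
    have hx1 : Valued.v (x - 1) = exp (-((jl : ℤ) - m)) := by
      have hlt : Valued.v (κ - x) < Valued.v (κ - 1) := by
        rw [hκm]; exact hκx.trans_lt (by rw [exp_lt_exp]; omega)
      have := Valuation.map_sub_eq_of_lt_left Valued.v (x := κ - 1) (y := κ - x) hlt
      rw [sub_sub_sub_cancel_left] at this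
      rw [this, hκm]
    have hx1' : Valued.v (x - 1) = Valued.v (σ' n₂ - n₂) := by
      rw [hxdef, div_sub_one ((map_ne_zero jK).2 hn₂0), map_div₀, hjv, hvn₂, div_one, ← map_sub, hjv]
    have hskew : σ' (σ' n₂ - n₂) = -(σ' n₂ - n₂) := by rw [map_sub, hσ']; ring
    have hsk0 : σ' n₂ - n₂ ≠ 0 := by
      intro h0
      rw [hx1', h0, map_zero] at hx1
      exact exp_ne_zero hx1.symm
    obtain ⟨k₀, hk₀⟩ := exists_v_eq_exp_of_map_eq_neg hσ' hfix' hπ' hdd' hskew hsk0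
    have hdeep : Valued.v (σ' n₂ - n₂) ≤ exp (-(d : ℤ)) := by
      rw [← neg_sub, Valuation.map_neg]
      refine (v_sub_map_le_of_v_le_one hσ' hfix' hπ' hdd' hvn₂.le).trans_eq ?_
      rw [hπ', ← exp_nsmul, nsmul_eq_mul, mul_neg, mul_one]
    rw [hx1'] at hx1
    have hpar : 2 * k₀ - (d : ℤ) = -((jl : ℤ) - m) := by rw [hk₀, exp_inj] at hx1; exact hx1
    have hge : (jl : ℤ) - m ≥ d := by rw [hx1, exp_le_exp] at hdeep; omega
    refine ⟨⟨(-k₀).toNat, by omega⟩, ?_⟩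
    -- the bound
    have hmin := min_le_of_thetaFixed_near hρρ hvρ hΘΘ hΘρ hvΘ hα1 hα hρϖE hϖE hσ' hfix' hπ' hdd' jK hjv hjfix hjσ hκ hΘx hx
      (s := s) (by omega) hκx hκΘ
    rcases min_le_iff.1 hmin with h1 | h1 <;> omega
  · rintro ⟨⟨k, hk⟩, hbd⟩
    -- EXISTENCE: a Θ-fixed ρ-norm-one `x` within `exp(−(jλ − d + 1)) ≤ exp(−s₀)` of `κ`
    obtain ⟨x, hΘx, hx, hκx⟩ := exists_thetaFixed_normOne_near hρρ hvρ hΘΘ hΘρ hvΘ hϖE h2 hσ' hvσ' hfix' hπ' hdd' hd jK hjv hjΘ hjfix hjσ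
      hnorm hκ (jl := jl) hκΘ.le (by omega)
    have hκx' : Valued.v (κ - x) ≤ exp (-(s : ℤ)) := hκx.trans (by rw [exp_le_exp]; omega)
    have hvx : Valued.v x = 1 := v_eq_one_of_v_mul_map_eq_one hvρ (by rw [hx]; exact Valuation.map_one _)
    have hx0 : x ≠ 0 := fun h0 => by rw [h0, map_zero] at hvx; exact zero_ne_one hvx
    -- the depth of `x` is `ℓ ≥ d`, so `x = a'∕σ'a'` with a unit `a'`
    have hx1 : Valued.v (x - 1) = exp (-((jl : ℤ) - m)) := by
      have hlt : Valued.v (κ - x) < Valued.v (κ - 1) := by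
        rw [hκm]; exact hκx'.trans_lt (by rw [exp_lt_exp]; omega)
      have := Valuation.map_sub_eq_of_lt_left Valued.v (x := κ - 1) (y := κ - x) hlt
      rw [sub_sub_sub_cancel_left] at this
      rw [this, hκm]
    obtain ⟨x', hx'⟩ := hjfix x hΘx
    have hx'0 : x' ≠ 0 := by rintro rfl; rw [map_zero] at hx'; exact hx0 hx'.symm
    have hx'n : x' * σ' x' = 1 := jK.injective (by rw [map_mul, hjσ, hx', hx, map_one])
    have hdepth : Valued.v (x' - 1) ≤ Valued.v π' ^ d := by
      rw [← hjv, map_sub, map_one, hx', hx1, hπ', ← exp_nsmul, nsmul_eq_mul, exp_le_exp]; omega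
    obtain ⟨a', ha'1, hxa'⟩ := exists_unit_eq_div_map hσ' hvσ' hfix' hπ' hdd' hd hx'n hdepth
    have ha'0 : a' ≠ 0 := fun h0 => by rw [h0, map_zero] at ha'1; exact zero_ne_one ha'1
    -- `N := N₀ · jK(σ'a')`
    refine ⟨(ω₀ : K) * Θ ω₀ * jK (σ' a'), by rw [map_mul, hN0Θ, hjΘ], by rw [map_mul, hvN0, hjv, hvσ', ha'1, mul_one], ?_⟩
    have hquot : ρ h / h * (ρ ((ω₀ : K) * Θ ω₀ * jK (σ' a')) / ((ω₀ : K) * Θ ω₀ * jK (σ' a'))) = -x := by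
      have hjσa : jK (σ' (σ' a')) = jK a' := by rw [hσ']
      rw [map_mul ρ, ← hjσ, hjσa, mul_div_mul_comm, ← mul_assoc, hη, ← map_div₀, ← hxa', hx', neg_one_mul]
    rw [hquot, ← sub_eq_neg_add]; exact hκx'

/-- **(R1-TOP-SIDE, ANISOTROPIC) AT A FREE THRESHOLD.**  ★ `topBit_aniso_iff` with the cell threshold replaced by any `s` with `jl < s + m`:
`[∃ Θ-fixed unit N : |(ρh∕h)(ρN∕N) + ρμ∕μ| ≤ exp(−s)] ⟺ jλ + 1 = d + m ∧ s + d ≤ jλ + 1` (the coset `−η·T♮⁰` sits at the single depth `d − 1`).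
[cite: Serre1979, Ch. V §3 Prop. 5, Cor. 3] [cite: Jacobowitz1962, §4] [cite: Flicker1998UnitaryFL, p. 84] -/
theorem topBit_aniso_iff_threshold [IsAdicComplete 𝓂[K'] 𝒪[K']]
    (hρρ : ∀ x, ρ (ρ x) = x) (hvρ : ∀ x, Valued.v (ρ x) = Valued.v x) (hΘΘ : ∀ x, Θ (Θ x) = x) (hΘρ : ∀ x, Θ (ρ x) = ρ (Θ x))
    (hvΘ : ∀ x, Valued.v (Θ x) = Valued.v x) (hα1 : Valued.v α ≤ 1) (hα : Valued.v (α - ρ α) = 1)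
    (hρϖE : ρ ϖE = ϖE) (hϖE : Valued.v ϖE = exp (-1 : ℤ)) (h2 : Valued.v (2 : K) = Valued.v ϖE ^ t) (hΘh : Θ h = h) (hh : h ≠ 0)
    (hσ' : ∀ x, σ' (σ' x) = x) (hvσ' : ∀ x, Valued.v (σ' x) = Valued.v x) (hfix' : ∀ x : K', σ' x = x → x ≠ 0 → ∃ n : ℤ, Valued.v x = exp (2 * n))
    (hπ' : Valued.v π' = exp (-1 : ℤ)) (hdd' : Valued.v (π' - σ' π') = Valued.v π' ^ d) (hd : 1 ≤ d)
    (jK : K' →+* K) (hjv : ∀ x, Valued.v (jK x) = Valued.v x) (hjΘ : ∀ x, Θ (jK x) = jK x)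
    (hjfix : ∀ z : K, Θ z = z → ∃ x, jK x = z) (hjσ : ∀ x, jK (σ' x) = ρ (jK x))
    (hnorm : ∀ z : Kˣ, Θ (z : K) = z → Valued.v (z : K) = 1 → ∃ ω : Kˣ, Valued.v (ω : K) = 1 ∧ (ω : K) * Θ ω = z)
    (haniso : ¬ ∃ x : K, x ≠ 0 ∧ h * Θ x * x + ρ (h * Θ x * x) = 0)
    {lam u : K} (hlam : lam * Θ lam = 1) (hu : ρ u = u) (hu1 : u * Θ u = 1)
    {m jl : ℕ} (hm : Valued.v (lam - u) = exp (-(m : ℤ))) (hjl : Valued.v ((lam - u) - ρ (lam - u)) = exp (-(jl : ℤ)))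
    (s : ℕ) (hs : jl < s + m) :
    (∃ N : K, Θ N = N ∧ Valued.v N = 1 ∧ Valued.v (ρ h / h * (ρ N / N) + ρ (lam - u) / (lam - u)) ≤ exp (-(s : ℤ))) ↔
      (jl + 1 = d + m ∧ s + d ≤ jl + 1) := by
  obtain ⟨hκ1, hκ, hκm, hκΘ, hmjl⟩ := token_kappa hρρ hvρ hΘρ hvΘ hlam hu hu1 hm hjl
  set κ : K := ρ (lam - u) / (lam - u) with hκdef
  have hρh0 : ρ h ≠ 0 := (map_ne_zero ρ).2 hh
  -- parity of an anisotropic scalar and the constancy of the twist depth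
  obtain ⟨n, hvh⟩ := exists_v_eq_exp_of_aniso hΘh hh hσ' hvσ' hπ' hdd' jK hjv hjΘ hjfix hjσ hnorm haniso
  have hconst := v_one_add_twist_eq_of_parity hΘΘ hvΘ hΘh hh hσ' hvσ' hfix' hπ' hdd' hd jK hjv hjfix hjσ hvh
  constructor
  · rintro ⟨N, hΘN, hN1, hbit⟩
    have hN0 : N ≠ 0 := fun h0 => by rw [h0, map_zero] at hN1; exact zero_ne_one hN1
    obtain ⟨ω, hω, hωN⟩ := hnorm (Units.mk0 N hN0) (by rw [Units.val_mk0, hΘN]) (by rw [Units.val_mk0, hN1])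
    rw [Units.val_mk0] at hωN
    set x : K := -(ρ h / h * (ρ N / N)) with hxdef
    have hΘx : Θ x = x := by rw [hxdef, map_neg, map_mul, map_div₀, map_div₀, hΘρ, hΘh, hΘρ, hΘN]
    have hx : x * ρ x = 1 := by
      have hρN0 : ρ N ≠ 0 := (map_ne_zero ρ).2 hN0
      rw [hxdef, map_neg, map_mul, map_div₀, map_div₀, hρρ, hρρ, neg_mul_neg]
      field_simp
    have hκx : Valued.v (κ - x) ≤ exp (-(s : ℤ)) := by rw [hxdef, sub_neg_eq_add, add_comm]; exact hbit
    -- the depth of `x` is `d − 1`, hence `ℓ = d − 1`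
    have hx1 : Valued.v (x - 1) = exp (1 - (d : ℤ)) := by
      rw [hxdef, ← hωN, show -(ρ h / h * (ρ ((ω : K) * Θ ω) / ((ω : K) * Θ ω))) - 1 = -(1 + ρ h / h * (ρ ((ω : K) * Θ ω) / ((ω : K) * Θ ω))) by ring,
        Valuation.map_neg, hconst ω hω]
    have hℓ : (jl : ℤ) - m = d - 1 := by
      have hlt : Valued.v (κ - x) < Valued.v (κ - 1) := by
        rw [hκm]; exact hκx.trans_lt (by rw [exp_lt_exp]; omega)
      have := Valuation.map_sub_eq_of_lt_left Valued.v (x := κ - 1) (y := κ - x) hlt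
      rw [sub_sub_sub_cancel_left, hx1, hκm, exp_inj] at this
      omega
    refine ⟨by omega, ?_⟩
    have hmin := min_le_of_thetaFixed_near hρρ hvρ hΘΘ hΘρ hvΘ hα1 hα hρϖE hϖE hσ' hfix' hπ' hdd' jK hjv hjfix hjσ hκ hΘx hx
      (s := s) (by omega) hκx hκΘ
    rcases min_le_iff.1 hmin with h1 | h1 <;> omega
  · rintro ⟨hℓ, hbd⟩
    obtain ⟨x, hΘx, hx, hκx⟩ := exists_thetaFixed_normOne_near hρρ hvρ hΘΘ hΘρ hvΘ hϖE h2 hσ' hvσ' hfix' hπ' hdd' hd jK hjv hjΘ hjfix hjσ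
      hnorm hκ (jl := jl) hκΘ.le (by omega)
    have hκx' : Valued.v (κ - x) ≤ exp (-(s : ℤ)) := hκx.trans (by rw [exp_le_exp]; omega)
    have hvx : Valued.v x = 1 := v_eq_one_of_v_mul_map_eq_one hvρ (by rw [hx]; exact Valuation.map_one _)
    have hx0 : x ≠ 0 := fun h0 => by rw [h0, map_zero] at hvx; exact zero_ne_one hvx
    have hx1 : Valued.v (x - 1) = exp (1 - (d : ℤ)) := by
      have hlt : Valued.v (κ - x) < Valued.v (κ - 1) := by
        rw [hκm]; exact hκx'.trans_lt (by rw [exp_lt_exp]; omega)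
      have := Valuation.map_sub_eq_of_lt_left Valued.v (x := κ - 1) (y := κ - x) hlt
      rw [sub_sub_sub_cancel_left] at this
      rw [this, hκm]; congr 1; omega
    -- `x = jK x'`, `x' = a₁∕σ'a₁` with `|a₁| = |π'|` (a unit representative would make `x` deeper than `d − 1`)
    obtain ⟨x', hx'⟩ := hjfix x hΘx
    have hx'0 : x' ≠ 0 := by rintro rfl; rw [map_zero] at hx'; exact hx0 hx'.symm
    have hx'n : x' * σ' x' = 1 := jK.injective (by rw [map_mul, hjσ, hx', hx, map_one])
    obtain ⟨a₁, hxa₁, ha₁⟩ := exists_rep_of_mul_map_eq_one hσ' hvσ' hπ' hdd' hx'n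
    have ha₁π : Valued.v a₁ = Valued.v π' := by
      rcases ha₁ with ha₁ | ha₁
      · exfalso
        have hle := v_div_map_sub_one_le_of_v_eq_one hσ' hvσ' hfix' hπ' hdd' ha₁
        rw [← hxa₁, ← hjv, map_sub, map_one, hx', hx1, hπ', ← exp_nsmul, nsmul_eq_mul, exp_le_exp] at hle
        omega
      · exact ha₁
    have ha₁0 : a₁ ≠ 0 := by rw [← (Valuation.ne_zero_iff Valued.v), ha₁π]; exact (Valuation.ne_zero_iff _).2 (v_varpi_zpow hπ' 0).1
    -- `h = jK h'`, the skew `e = π' − σ'π'`, and the unit `N' := σ'(e·a₁·h')·(π'σ'π')^(n − d)`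
    obtain ⟨h', hh'⟩ := hjfix h hΘh
    have hh'0 : h' ≠ 0 := by rintro rfl; rw [map_zero] at hh'; exact hh hh'.symm
    have hvh' : Valued.v h' = exp (2 * n + 1 - d) := by rw [← hjv, hh', hvh]
    have hπ0 : π' ≠ 0 := (v_varpi_zpow hπ' 0).1
    have he0 : π' - σ' π' ≠ 0 := sub_map_ne_zero hπ' hdd'
    have hσe : σ' (π' - σ' π') = -(π' - σ' π') := by rw [map_sub, hσ']; ring
    have hP0 : π' * σ' π' ≠ 0 := mul_ne_zero hπ0 ((map_ne_zero σ').2 hπ0)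
    have hσP : σ' ((π' * σ' π') ^ ((n : ℤ) - d)) = (π' * σ' π') ^ ((n : ℤ) - d) := by rw [map_zpow₀, map_mul_map hσ']
    set g : K' := (π' - σ' π') * a₁ * h' with hgdef
    have hg0 : g ≠ 0 := mul_ne_zero (mul_ne_zero he0 ha₁0) hh'0
    have hvg : Valued.v (σ' g) = exp (2 * n - 2 * (d : ℤ)) := by
      rw [hvσ', hgdef, map_mul, map_mul, hdd', ha₁π, hvh', hπ', ← exp_nsmul, nsmul_eq_mul, ← exp_add, ← exp_add]; congr 1; ring
    set N' : K' := σ' g * (π' * σ' π') ^ ((n : ℤ) - d) with hN'def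
    have hvN' : Valued.v N' = 1 := by
      rw [hN'def, map_mul, hvg, map_zpow₀, map_mul, hvσ', hπ', ← exp_add, ← exp_zsmul, smul_eq_mul, ← exp_add, ← exp_zero]; congr 1; ring
    have hquot' : σ' N' / N' = g / σ' g := by
      rw [hN'def, map_mul, hσ', hσP, mul_div_mul_right _ _ (zpow_ne_zero _ hP0)]
    -- `−x'∕η' = g∕σ'g`
    have hgx : g / σ' g = -(x' * (h' / σ' h')) := by
      rw [hgdef, map_mul, map_mul, hσe, hxa₁]
      have hσa₁0 : σ' a₁ ≠ 0 := (map_ne_zero σ').2 ha₁0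
      have hσh'0 : σ' h' ≠ 0 := (map_ne_zero σ').2 hh'0
      field_simp
    refine ⟨jK N', hjΘ N', by rw [hjv, hvN'], ?_⟩
    have hquot : ρ h / h * (ρ (jK N') / jK N') = -x := by
      rw [← hjσ, ← map_div₀, hquot', hgx, map_neg, map_mul, map_div₀, hjσ, hh', hx']
      field_simp
    rw [hquot, ← sub_eq_neg_add]; exact hκx'

/-! ## §2 The top row of the scaled multiplier `μ₁ = t⁻¹(λ − u)`: alive up to the UNSCALED conductor -/

open scoped Classical in
/-- **(D3♯)-Unr, HYPERBOLIC — THE TOP CELLS OF THE SCALED MULTIPLIER.**  `μ₁ = t⁻¹(λ − u)` with `ρ t = t`, `|t| = exp(−e)` (tokens `m₁ + e = m`, `jλ₁ + e = jλ`); on a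
top cell of `μ₁` (`j ≤ jλ₁`, `1 ≤ a`, `j + m₁ = jλ₁ + a`, `m₁ + 1 ≤ 2a`), for a HYPERBOLIC scalar `h`:
`(q−1)·q^{⌈(2a−m₁)∕2⌉−1}·#levelSetDep_h(j,a;μ₁) = [(d + m₁ ≤ jλ₁ ∧ jλ₁ − d − m₁ even) ∧ 2j + d ≤ 2jλ₁ + 1 + e]·#levelSet_h(j,a)` — the sheet-v5 `hvTopP` sentence at `μ₁`'s
tokens with the alive conjunct shifted by `e` (★ `ncard_levelSetDep_top_hyper` at `μ₁` + §1 at `s = j + a − m₁`, `ρμ₁∕μ₁ = ρμ∕μ`).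
[cite: Jacobowitz1962, §4] [cite: Serre1979, Ch. V §3 Prop. 5, Cor. 3] [cite: Flicker1998UnitaryFL, p. 84] -/
theorem ncard_levelSetDep_top_hyper_inv_mul [IsAdicComplete 𝓂[K'] 𝒪[K']]
    (hρρ : ∀ x, ρ (ρ x) = x) (hvρ : ∀ x, Valued.v (ρ x) = Valued.v x) (hΘΘ : ∀ x, Θ (Θ x) = x) (hΘρ : ∀ x, Θ (ρ x) = ρ (Θ x))
    (hvΘ : ∀ x, Valued.v (Θ x) = Valued.v x) (hα1 : Valued.v α ≤ 1) (hα : Valued.v (α - ρ α) = 1)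
    (hρϖE : ρ ϖE = ϖE) (hϖE : Valued.v ϖE = exp (-1 : ℤ)) (h2 : Valued.v (2 : K) = Valued.v ϖE ^ t) (hΘh : Θ h = h) (hh : h ≠ 0)
    [IsDiscreteValuationRing 𝒪[K]] [Finite 𝓀[K]] (hq : Nat.card 𝓀[K] = q ^ 2)
    (hσ' : ∀ x, σ' (σ' x) = x) (hvσ' : ∀ x, Valued.v (σ' x) = Valued.v x) (hfix' : ∀ x : K', σ' x = x → x ≠ 0 → ∃ n : ℤ, Valued.v x = exp (2 * n))
    (hπ' : Valued.v π' = exp (-1 : ℤ)) (hdd' : Valued.v (π' - σ' π') = Valued.v π' ^ d) (hd : 1 ≤ d) [IsDiscreteValuationRing 𝒪[K']] [Finite 𝓀[K']]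
    (hq' : Nat.card 𝓀[K'] = q) (jK : K' →+* K) (hjv : ∀ x, Valued.v (jK x) = Valued.v x) (hjΘ : ∀ x, Θ (jK x) = jK x)
    (hjfix : ∀ z : K, Θ z = z → ∃ x, jK x = z) (hjσ : ∀ x, jK (σ' x) = ρ (jK x))
    (hnorm : ∀ z : Kˣ, Θ (z : K) = z → Valued.v (z : K) = 1 → ∃ ω : Kˣ, Valued.v (ω : K) = 1 ∧ (ω : K) * Θ ω = z)
    (hhyper : ∃ x : K, x ≠ 0 ∧ h * Θ x * x + ρ (h * Θ x * x) = 0)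
    {lam u : K} (hlam : lam * Θ lam = 1) (hu : ρ u = u) (hu1 : u * Θ u = 1)
    {m jl : ℕ} (hm : Valued.v (lam - u) = exp (-(m : ℤ))) (hjl : Valued.v ((lam - u) - ρ (lam - u)) = exp (-(jl : ℤ)))
    {tc : K} (hρt : ρ tc = tc) {e : ℕ} (hte : Valued.v tc = exp (-(e : ℤ))) {m₁ jl₁ : ℕ} (hme : m₁ + e = m) (hjle : jl₁ + e = jl)
    {j a : ℕ} (hj : j ≤ jl₁) (ha : 1 ≤ a) (hdiag : j + m₁ = jl₁ + a) (htop : m₁ + 1 ≤ 2 * a) :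
    (q - 1) * q ^ ((2 * a - m₁ + 1) / 2 - 1) * (levelSetDep ρ Θ α ϖE h j a (tc⁻¹ * (lam - u))).ncard =
      if (d + m₁ ≤ jl₁ ∧ (jl₁ - d - m₁) % 2 = 0) ∧ 2 * j + d ≤ 2 * jl₁ + 1 + e then (levelSet ρ Θ α ϖE h j a).ncard else 0 := by
  have htc0 : tc ≠ 0 := fun h0 => by rw [h0, map_zero] at hte; exact (exp_ne_zero hte.symm).elim
  -- the tokens of `μ₁`
  have hm₁ : Valued.v (tc⁻¹ * (lam - u)) = exp (-(m₁ : ℤ)) := by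
    rw [map_mul, map_inv₀, hte, hm, ← exp_neg, ← exp_add]; congr 1; omega
  have hjl₁ : Valued.v (tc⁻¹ * (lam - u) - ρ (tc⁻¹ * (lam - u))) = exp (-(jl₁ : ℤ)) := by
    rw [map_mul ρ, map_inv₀, hρt, ← mul_sub, map_mul, map_inv₀, hte, hjl, ← exp_neg, ← exp_add]; congr 1; omega
  -- ★ (R1-TOP, HYPERBOLIC) at `μ₁`
  have H := ncard_levelSetDep_top_hyper hρρ hvρ hΘΘ hΘρ hvΘ hα1 hα hρϖE hϖE hΘh hh hq hσ' hvσ' hfix' hπ' hdd' hd hq' jK hjv hjΘ hjfix hjσ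
    hnorm hhyper hm₁ hjl₁ hj ha hdiag htop
  -- the twist of `μ₁` is the twist of `μ`; the threshold is `s = j + a − m₁`
  have hquot : ρ (tc⁻¹ * (lam - u)) / (tc⁻¹ * (lam - u)) = ρ (lam - u) / (lam - u) := by
    rw [map_mul ρ, map_inv₀, hρt, mul_div_mul_left _ _ (inv_ne_zero htc0)]
  have hmjl : m ≤ jl := (token_kappa hρρ hvρ hΘρ hvΘ hlam hu hu1 hm hjl).2.2.2.2
  have hs : (-((j + a : ℕ) - (m₁ : ℤ))) = -((j + a - m₁ : ℕ) : ℤ) := by push_cast; omega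
  rw [hquot, hs] at H
  have B := topBit_hyper_iff_threshold hρρ hvρ hΘΘ hΘρ hvΘ hα1 hα hρϖE hϖE h2 hΘh hh hσ' hvσ' hfix' hπ' hdd' hd jK hjv hjΘ hjfix hjσ hnorm hhyper
    hlam hu hu1 hm hjl (j + a - m₁) (by omega)
  by_cases hc : (d + m₁ ≤ jl₁ ∧ (jl₁ - d - m₁) % 2 = 0) ∧ 2 * j + d ≤ 2 * jl₁ + 1 + e
  · rw [if_pos hc, H, if_pos (B.2 ⟨⟨(jl₁ - d - m₁) / 2, by omega⟩, by omega⟩)]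
  · rw [if_neg hc, H, if_neg (fun h1 => hc ?_)]
    obtain ⟨⟨k, hk⟩, hbd⟩ := B.1 h1
    exact ⟨⟨by omega, by omega⟩, by omega⟩

open scoped Classical in
/-- **(D3♯)-Unr, ANISOTROPIC — THE TOP CELLS OF THE SCALED MULTIPLIER.**  Same cell of `μ₁ = t⁻¹(λ − u)`, ANISOTROPIC scalar `h`:
`q^{⌊(2a−m₁)∕2⌋}·#levelSetDep_h(j,a;μ₁) = [jλ₁ + 1 = d + m₁ ∧ 2j + d ≤ 2jλ₁ + 1 + e]·#levelSet_h(j,a)` — the sheet-v5 `hvTopM` sentence at `μ₁`'s tokens with the alive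
conjunct shifted by `e` (★ `ncard_levelSetDep_top_aniso` at `μ₁` + §1).  [cite: Jacobowitz1962, §4] [cite: Serre1979, Ch. V §3 Prop. 5, Cor. 3] [cite: Flicker1998UnitaryFL, p. 84] -/
theorem ncard_levelSetDep_top_aniso_inv_mul [IsAdicComplete 𝓂[K'] 𝒪[K']]
    (hρρ : ∀ x, ρ (ρ x) = x) (hvρ : ∀ x, Valued.v (ρ x) = Valued.v x) (hΘΘ : ∀ x, Θ (Θ x) = x) (hΘρ : ∀ x, Θ (ρ x) = ρ (Θ x))
    (hvΘ : ∀ x, Valued.v (Θ x) = Valued.v x) (hα1 : Valued.v α ≤ 1) (hα : Valued.v (α - ρ α) = 1)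
    (hρϖE : ρ ϖE = ϖE) (hϖE : Valued.v ϖE = exp (-1 : ℤ)) (h2 : Valued.v (2 : K) = Valued.v ϖE ^ t) (hΘh : Θ h = h) (hh : h ≠ 0)
    [IsDiscreteValuationRing 𝒪[K]] [Finite 𝓀[K]] (hq : Nat.card 𝓀[K] = q ^ 2)
    (hσ' : ∀ x, σ' (σ' x) = x) (hvσ' : ∀ x, Valued.v (σ' x) = Valued.v x) (hfix' : ∀ x : K', σ' x = x → x ≠ 0 → ∃ n : ℤ, Valued.v x = exp (2 * n))
    (hπ' : Valued.v π' = exp (-1 : ℤ)) (hdd' : Valued.v (π' - σ' π') = Valued.v π' ^ d) (hd : 1 ≤ d) [IsDiscreteValuationRing 𝒪[K']] [Finite 𝓀[K']]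
    (hq' : Nat.card 𝓀[K'] = q) (jK : K' →+* K) (hjv : ∀ x, Valued.v (jK x) = Valued.v x) (hjΘ : ∀ x, Θ (jK x) = jK x)
    (hjfix : ∀ z : K, Θ z = z → ∃ x, jK x = z) (hjσ : ∀ x, jK (σ' x) = ρ (jK x))
    (hnorm : ∀ z : Kˣ, Θ (z : K) = z → Valued.v (z : K) = 1 → ∃ ω : Kˣ, Valued.v (ω : K) = 1 ∧ (ω : K) * Θ ω = z)
    (haniso : ¬ ∃ x : K, x ≠ 0 ∧ h * Θ x * x + ρ (h * Θ x * x) = 0)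
    {lam u : K} (hlam : lam * Θ lam = 1) (hu : ρ u = u) (hu1 : u * Θ u = 1)
    {m jl : ℕ} (hm : Valued.v (lam - u) = exp (-(m : ℤ))) (hjl : Valued.v ((lam - u) - ρ (lam - u)) = exp (-(jl : ℤ)))
    {tc : K} (hρt : ρ tc = tc) {e : ℕ} (hte : Valued.v tc = exp (-(e : ℤ))) {m₁ jl₁ : ℕ} (hme : m₁ + e = m) (hjle : jl₁ + e = jl)
    {j a : ℕ} (hj : j ≤ jl₁) (ha : 1 ≤ a) (hdiag : j + m₁ = jl₁ + a) (htop : m₁ + 1 ≤ 2 * a) :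
    q ^ ((2 * a - m₁) / 2) * (levelSetDep ρ Θ α ϖE h j a (tc⁻¹ * (lam - u))).ncard =
      if jl₁ + 1 = d + m₁ ∧ 2 * j + d ≤ 2 * jl₁ + 1 + e then (levelSet ρ Θ α ϖE h j a).ncard else 0 := by
  have htc0 : tc ≠ 0 := fun h0 => by rw [h0, map_zero] at hte; exact (exp_ne_zero hte.symm).elim
  have hm₁ : Valued.v (tc⁻¹ * (lam - u)) = exp (-(m₁ : ℤ)) := by
    rw [map_mul, map_inv₀, hte, hm, ← exp_neg, ← exp_add]; congr 1; omega
  have hjl₁ : Valued.v (tc⁻¹ * (lam - u) - ρ (tc⁻¹ * (lam - u))) = exp (-(jl₁ : ℤ)) := by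
    rw [map_mul ρ, map_inv₀, hρt, ← mul_sub, map_mul, map_inv₀, hte, hjl, ← exp_neg, ← exp_add]; congr 1; omega
  have H := ncard_levelSetDep_top_aniso hρρ hvρ hΘΘ hΘρ hvΘ hα1 hα hρϖE hϖE hΘh hh hq hσ' hvσ' hfix' hπ' hdd' hd hq' jK hjv hjΘ hjfix hjσ
    hnorm haniso hm₁ hjl₁ hj ha hdiag htop
  have hquot : ρ (tc⁻¹ * (lam - u)) / (tc⁻¹ * (lam - u)) = ρ (lam - u) / (lam - u) := by
    rw [map_mul ρ, map_inv₀, hρt, mul_div_mul_left _ _ (inv_ne_zero htc0)]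
  have hmjl : m ≤ jl := (token_kappa hρρ hvρ hΘρ hvΘ hlam hu hu1 hm hjl).2.2.2.2
  have hs : (-((j + a : ℕ) - (m₁ : ℤ))) = -((j + a - m₁ : ℕ) : ℤ) := by push_cast; omega
  rw [hquot, hs] at H
  have B := topBit_aniso_iff_threshold hρρ hvρ hΘΘ hΘρ hvΘ hα1 hα hρϖE hϖE h2 hΘh hh hσ' hvσ' hfix' hπ' hdd' hd jK hjv hjΘ hjfix hjσ hnorm haniso
    hlam hu hu1 hm hjl (j + a - m₁) (by omega)
  by_cases hc : jl₁ + 1 = d + m₁ ∧ 2 * j + d ≤ 2 * jl₁ + 1 + e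
  · rw [if_pos hc, H, if_pos (B.2 ⟨by omega, by omega⟩)]
  · rw [if_neg hc, H, if_neg (fun h1 => hc ?_)]
    obtain ⟨hℓ, hbd⟩ := B.1 h1
    exact ⟨by omega, by omega⟩

end Summit.HodgeConjecture.HodgeConjecture.Cruxes.H413.F0P3cDyRamToricLevelCensusUnrTopScaled
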